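import Summits.AtomisticToContinuum.FouriersLaw.Theorems.EmbeddedDrudeMourreDrudeDissolutionStubPencilFrameworkLocalityA
import Literature.MathematicalPhysics.KineticTheory.InfiniteChainL2Locality

/-!
# Stub F `stub_pencilFramework` of line `gram-pencil-harmonic-chaos`, part F-L2: fixed-time `L²`
locality of the Buttà–Marchioro flow for observables reading a box (probabilistic half)
(crux `EmbeddedDrudeMourre.DrudeDissolution`, stmt-AtomisticToContinuum-12593; `--supports` file)

The tree's `InfiniteChainDynamics.exists_summable_l2_locality` (file `InfiniteChainL2Locality`) is
stated for observables depending on the sites `-1, 0, 1`. Part F-L1 (`pencilFramework_localityA`)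
supplies the deterministic estimate for observables polynomially Lipschitz in the coordinates of an
arbitrary box `[-k, k]`, with conclusions of literally the same shape; this file re-runs the
probabilistic half verbatim: on the good event `{Q ≤ N}`, `N = n/(2c)`, the deterministic bound
`O(n^{2d_a+1} 32^{-n})`; off it, fourth moments (invariance of `μ` under both flows) and the
exponential tail (2.6) of `Q`, through `integral_sub_sq_le_of_bound_off`.

* `dependsOn_comp_severedFlow_box` — the approximant `a ∘ T^{Λ_{0,n}}_t` of an observable reading
  `[-k, k]` reads `[-(n+k+1), n+k+1]`;
* `pencilFramework_localityB` — for every `τ ≥ 0` a summable rate `ε ≥ 0` with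
  `‖a ∘ φ_t - a ∘ T^{Λ_{0,n}}_t‖_{L²(μ)} ≤ ε_n` for all `|t| ≤ τ`, `n`.
-/

noncomputable section

namespace Summit.AtomisticToContinuum.FouriersLaw.Theorems.DrudeDissolution.GramPencilHarmonicChaos

open MeasureTheory Filter Set Function Topology
open scoped InnerProductSpace ENNReal
open Literature.MathematicalPhysics.KineticTheory
open Literature.MathematicalPhysics.KineticTheory.HeatConduction
open Literature.MathematicalPhysics.KineticTheory.HeatConduction.OscillatorChain

variable {P : OscillatorChain} {s₁ s₂ : ℕ}

/-- **The approximant is local**: if `a` reads the box `[-k, k]` then `a ∘ T^{Λ_{0,n}}_t` reads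
`[-(n+k+1), n+k+1]` (inside `Λ_{0,n}` the severed flow reads `[-n-1, n+1]`, outside it is the
identity). [folklore] -/
theorem dependsOn_comp_severedFlow_box (hU : ContDiff ℝ 2 P.U) (hV : ContDiff ℝ 2 P.V)
    (hB1 : P.CondB1) {k : ℕ} {a : ChainConfig → ℝ} (had : DependsOn a (Icc (-(k : ℤ)) k)) (n : ℕ)
    (t : ℝ) :
    DependsOn (a ∘ severedFlow hB1 (Finset.Icc ((0 : ℤ) - n) ((0 : ℤ) + n)) t)
      (Icc (-(n : ℤ) - (k + 1)) (n + (k + 1))) := by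
  -- adapted from `InfiniteChainDynamics.dependsOn_comp_severedFlow`
  intro σ σ' h
  simp only [comp_apply]
  refine had fun i hi => ?_
  by_cases hiΛ : i ∈ Finset.Icc ((0 : ℤ) - n) ((0 : ℤ) + n)
  · refine severedFlow_cbox_dependsOn hU hV hB1 0 n t hiΛ fun j hj => h j ?_
    simp only [mem_Icc] at hj ⊢
    constructor <;> omega
  · rw [severedFlow_apply_of_not_mem hB1 _ t σ hiΛ, severedFlow_apply_of_not_mem hB1 _ t σ' hiΛ]
    refine h i ?_
    simp only [mem_Icc] at hi ⊢
    constructor <;> omega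

/-- **Part F-L2 of stub F: fixed-time `L²` locality of a `𝒳₀`-dynamics for observables reading a
box, uniformly on compact time intervals, with a summable rate.** Let `U`, `V` be even
non-negative polynomials of degrees `2s₁, 2s₂ ≥ 2`, `D` a dynamics with carrier `𝒳₀`, `μ` a state
with BM's superstability estimate (2.3) preserved by `D` and by every severed flow `T^{Λ_{0,n}}_t`;
let `a` be measurable, reading the box `[-k, k]`, with `a⁴ ∈ L¹(μ)`, `a ∈ L²(μ)`, and
polynomially Lipschitz in the coordinates of `[-k, k]`. Then for every `τ ≥ 0` there is a summable
`ε ≥ 0` such that for all `|t| ≤ τ` and `n` the local approximant `g = a ∘ T^{Λ_{0,n}}_t` (reading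
`[-(n+k+1), n+k+1]`, measurable, in `L²(μ)`) satisfies `(∫ (a ∘ φ_t - g)² dμ)^{1/2} ≤ ε_n` — the
tree's `exists_summable_l2_locality` (sites `-1, 0, 1`), same proof, fed with part F-L1.
[cite: ButtaMarchioro2016, §3 eqs. (3.7), (3.14)–(3.16) and §2 eq. (2.6)] -/
theorem pencilFramework_localityB : ∀ (P : Literature.MathematicalPhysics.KineticTheory.HeatConduction.OscillatorChain) (s₁ s₂ : ℕ) (D : Literature.MathematicalPhysics.KineticTheory.HeatConduction.InfiniteChainDynamics P), 1 ≤ s₁ → 1 ≤ s₂ → Literature.MathematicalPhysics.KineticTheory.HeatConduction.OscillatorChain.IsEvenPolyOfDegree P.U s₁ → Literature.MathematicalPhysics.KineticTheory.HeatConduction.OscillatorChain.IsEvenPolyOfDegree P.V s₂ → D.carrier = P.bmGood → ∀ (hB1 : P.CondB1) (μ : MeasureTheory.Measure Literature.MathematicalPhysics.KineticTheory.HeatConduction.ChainConfig), P.HasSuperstabilityEstimate μ → D.PreservesMeasure μ → (∀ (n : ℕ) (t : ℝ), MeasureTheory.MeasurePreserving (Literature.MathematicalPhysics.KineticTheory.HeatConduction.OscillatorChain.severedFlow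 hB1 (Finset.Icc ((0 : ℤ) - n) ((0 : ℤ) + n)) t) μ μ) → ∀ (k : ℕ) (a : Literature.MathematicalPhysics.KineticTheory.HeatConduction.ChainConfig → ℝ), Measurable a → DependsOn a (Set.Icc (-(k : ℤ)) k) → MeasureTheory.MemLp a 2 μ → MeasureTheory.Integrable (fun σ => a σ ^ 4) μ → ∀ (Ca : ℝ) (da : ℕ), 0 ≤ Ca → (∀ (σ σ' : Literature.MathematicalPhysics.KineticTheory.HeatConduction.ChainConfig) (R δ : ℝ), 1 ≤ R → 0 ≤ δ → δ ≤ 1 → (∀ i : ℤ, -(k : ℤ) ≤ i → i ≤ k → |(σ' i).1| ≤ R ∧ |(σ' i).2| ≤ R ∧ |(σ i).1 - (σ' i).1| ≤ δ ∧ |(σ i).2 - (σ' i).2| ≤ δ) → |a σ - a σ'| ≤ Ca * R ^ da * δ) → ∀ τ : ℝ, 0 ≤ τ → ∃ ε : ℕ → ℝ, (∀ n, 0 ≤ ε n) ∧ Summable ε ∧ ∀ t : ℝ, |t| ≤ τ → ∀ n : ℕ, DependsOn (a ∘ Literature.MathematicalPhysics.KineticTheory.HeatConduction.OscillatorChain.severedFlow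 hB1 (Finset.Icc ((0 : ℤ) - n) ((0 : ℤ) + n)) t) (Set.Icc (-(n : ℤ) - (k + 1)) (n + (k + 1))) ∧ Measurable (a ∘ Literature.MathematicalPhysics.KineticTheory.HeatConduction.OscillatorChain.severedFlow hB1 (Finset.Icc ((0 : ℤ) - n) ((0 : ℤ) + n)) t) ∧ MeasureTheory.MemLp (a ∘ Literature.MathematicalPhysics.KineticTheory.HeatConduction.OscillatorChain.severedFlow hB1 (Finset.Icc ((0 : ℤ) - n) ((0 : ℤ) + n)) t) 2 μ ∧ Real.sqrt (∫ σ, (a (D.flow t σ) - a (Literature.MathematicalPhysics.KineticTheory.HeatConduction.OscillatorChain.severedFlow hB1 (Finset.Icc ((0 : ℤ) - n) ((0 : ℤ) + n)) t σ)) ^ 2 ∂μ) ≤ ε n := by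
  -- adapted from `InfiniteChainDynamics.exists_summable_l2_locality` (sites `-1,0,1` ↦ `[-k,k]`)
  intro P s₁ s₂ D hs₁ hs₂ hU1 hV1 hcar hB1 μ hss hD hsev k a ham had ha2 ha4 Ca da hCa ha τ hτ
  haveI : IsProbabilityMeasure μ := hss.1
  have hU : ContDiff ℝ 2 P.U := hU1.contDiff_two
  have hV : ContDiff ℝ 2 P.V := hV1.contDiff_two
  have hUm : Measurable P.U := hU.continuous.measurable
  have hVm : Measurable P.V := hV.continuous.measurable
  -- the deterministic constants and the superstability constants
  obtain ⟨A, K, L, hA1, -, hK0, hL0, hdet⟩ :=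
    pencilFramework_localityA P s₁ s₂ D hs₁ hs₂ hU1 hV1 hcar hB1 k a Ca da ha
  obtain ⟨Cω, lam₀, hCω, hlam₀, hssb⟩ := hss.2
  obtain ⟨Kμ, hKμ, htail⟩ := P.measure_bmGrowthSet_gt_le hUm hVm hlam₀ (hssb lam₀ hlam₀ le_rfl)
  have hA0 : 0 ≤ A := zero_le_one.trans hA1
  -- the scale `c`
  obtain ⟨c, hc⟩ : ∃ c : ℝ, c = A * (1 + τ ^ 2 * (1 + τ)) := ⟨_, rfl⟩
  have hτ2 : 0 ≤ τ ^ 2 * (1 + τ) := by positivity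
  have hAτc : A * (τ ^ 2 * (1 + τ)) ≤ c := by rw [hc, mul_add, mul_one]; linarith
  have hAc : A ≤ c := by rw [hc]; nlinarith
  have hc1 : 1 ≤ c := hA1.trans hAc
  have hc0 : 0 < c := one_pos.trans_le hc1
  -- (C3): `(2 + 22 τ K n) · 32 · 32^{-n} ≤ 1` eventually
  have hδlim : Tendsto (fun n : ℕ => (2 + 22 * τ * K * n) * 32 * ((1 : ℝ) / 32) ^ n) atTop (𝓝 0) := by
    have h1 : Tendsto (fun n : ℕ => ((1 : ℝ) / 32) ^ n) atTop (𝓝 0) :=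
      tendsto_pow_atTop_nhds_zero_of_lt_one (by norm_num) (by norm_num)
    have h2 : Tendsto (fun n : ℕ => (n : ℝ) * ((1 : ℝ) / 32) ^ n) atTop (𝓝 0) :=
      tendsto_self_mul_const_pow_of_lt_one (by norm_num) (by norm_num)
    have h3 := (h1.const_mul (2 * 32)).add (h2.const_mul (22 * τ * K * 32))
    rw [mul_zero, mul_zero, add_zero] at h3
    refine h3.congr fun n => ?_
    ring
  obtain ⟨n₁, hn₁⟩ : ∃ n₁ : ℕ, ∀ n ≥ n₁, (2 + 22 * τ * K * n) * 32 * ((1 : ℝ) / 32) ^ n ≤ 1 := by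
    have h := (tendsto_order.1 hδlim).2 1 one_pos
    exact eventually_atTop.1 (h.mono fun n hn => hn.le)
  -- the threshold `n₀`
  obtain ⟨n₀, hn₀1, hn₀2, hn₀3, hn₀4⟩ : ∃ n₀ : ℕ, (8 + 2 * A ≤ (n₀ : ℝ)) ∧ (2 * c ≤ (n₀ : ℝ)) ∧
      (2 * c * (Cω + 3 / 2) / lam₀ ≤ (n₀ : ℝ)) ∧ n₁ ≤ n₀ := by
    set X : ℝ := max (8 + 2 * A) (max (2 * c) (2 * c * (Cω + 3 / 2) / lam₀)) with hX
    have hX1 : 8 + 2 * A ≤ X := le_max_left _ _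
    have hX2 : 2 * c ≤ X := (le_max_left _ _).trans (le_max_right _ _)
    have hX3 : 2 * c * (Cω + 3 / 2) / lam₀ ≤ X := (le_max_right _ _).trans (le_max_right _ _)
    have hXc : X ≤ ⌈X⌉₊ := Nat.le_ceil X
    have hn₁0 : (0 : ℝ) ≤ n₁ := Nat.cast_nonneg n₁
    refine ⟨⌈X⌉₊ + n₁, ?_, ?_, ?_, by omega⟩ <;> push_cast <;> linarith
  -- the constants of the rate
  obtain ⟨Cb, hCb⟩ : ∃ Cb : ℝ, Cb = 32 * Ca * (9 * L) ^ da * (2 + 22 * τ * K) := ⟨_, rfl⟩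
  have hCb0 : 0 ≤ Cb := by rw [hCb]; positivity
  obtain ⟨ρ, hρ⟩ : ∃ ρ : ℝ, ρ = Real.exp (-(lam₀ / (8 * c))) := ⟨_, rfl⟩
  have hρ0 : 0 ≤ ρ := by rw [hρ]; exact Real.exp_nonneg _
  have hρ1 : ρ < 1 := by rw [hρ]; exact Real.exp_lt_one_iff.2 (by rw [neg_lt_zero]; positivity)
  obtain ⟨M₄, hM₄⟩ : ∃ M₄ : ℝ, M₄ = ∫ σ, a σ ^ 4 ∂μ := ⟨_, rfl⟩
  have hM₄0 : 0 ≤ M₄ := by rw [hM₄]; exact integral_nonneg fun _ => by positivity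
  obtain ⟨Cη, hCη⟩ : ∃ Cη : ℝ, Cη = Real.sqrt (2 * (M₄ + Kμ.toReal)) * Real.exp (Cω / 4) := ⟨_, rfl⟩
  have hCη0 : 0 ≤ Cη := by rw [hCη]; positivity
  obtain ⟨E₀, hE₀⟩ : ∃ E₀ : ℝ, E₀ = Real.sqrt (∫ σ, a σ ^ 2 ∂μ) + Real.sqrt (∫ σ, a σ ^ 2 ∂μ) := ⟨_, rfl⟩
  have hE₀0 : 0 ≤ E₀ := by rw [hE₀]; positivity
  have hbn0 : ∀ n : ℕ, 0 ≤ Cb * (n : ℝ) ^ (2 * da + 1) * ((1 : ℝ) / 32) ^ n := fun n => by positivity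
  have hε0 : ∀ n : ℕ, 0 ≤ (if n < n₀ then E₀ else
      Cb * (n : ℝ) ^ (2 * da + 1) * ((1 : ℝ) / 32) ^ n + Cη * ρ ^ n) := fun n => by
    split_ifs
    · exact hE₀0
    · exact add_nonneg (hbn0 n) (by positivity)
  -- summability
  have hsum : Summable fun n : ℕ => (if n < n₀ then E₀ else
      Cb * (n : ℝ) ^ (2 * da + 1) * ((1 : ℝ) / 32) ^ n + Cη * ρ ^ n) := by
    have h1 : Summable fun n : ℕ => Cb * (n : ℝ) ^ (2 * da + 1) * ((1 : ℝ) / 32) ^ n := by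
      have := summable_pow_mul_geometric_of_norm_lt_one (2 * da + 1) (r := (1 : ℝ) / 32)
        (by rw [Real.norm_eq_abs, abs_of_pos (by norm_num)]; norm_num)
      exact (this.mul_left Cb).congr fun n => by ring
    have h2 : Summable fun n : ℕ => Cη * ρ ^ n := (summable_geometric_of_lt_one hρ0 hρ1).mul_left Cη
    have h3 : Summable fun n : ℕ => Cb * ((n + n₀ : ℕ) : ℝ) ^ (2 * da + 1) * ((1 : ℝ) / 32) ^ (n + n₀) +
        Cη * ρ ^ (n + n₀) :=
      (summable_nat_add_iff (f := fun n : ℕ => Cb * (n : ℝ) ^ (2 * da + 1) * ((1 : ℝ) / 32) ^ n +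
        Cη * ρ ^ n) n₀).2 (h1.add h2)
    refine (summable_nat_add_iff n₀).1 (h3.congr fun n => ?_)
    have hn : ¬ (n + n₀ < n₀) := by omega
    simp only [if_neg hn]
  refine ⟨fun n => if n < n₀ then E₀ else Cb * (n : ℝ) ^ (2 * da + 1) * ((1 : ℝ) / 32) ^ n + Cη * ρ ^ n,
    hε0, hsum, fun t ht n => ?_⟩
  -- the approximant
  have hsev' := hsev n t
  have hgm : Measurable (a ∘ severedFlow hB1 (Finset.Icc ((0 : ℤ) - n) ((0 : ℤ) + n)) t) :=
    ham.comp (measurable_severedFlow hB1 _ hU hV t)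
  have hg2 : MemLp (a ∘ severedFlow hB1 (Finset.Icc ((0 : ℤ) - n) ((0 : ℤ) + n)) t) 2 μ :=
    ha2.comp_measurePreserving hsev'
  refine ⟨dependsOn_comp_severedFlow_box hU hV hB1 had n t, hgm, hg2, ?_⟩
  -- the trivial bound
  have hφ2 : MemLp (a ∘ D.flow t) 2 μ := ha2.comp_measurePreserving (hD.2 t)
  have htriv : Real.sqrt (∫ σ, (a (D.flow t σ) -
      a (severedFlow hB1 (Finset.Icc ((0 : ℤ) - n) ((0 : ℤ) + n)) t σ)) ^ 2 ∂μ) ≤ E₀ := by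
    have h := sqrt_integral_sub_sq_le hφ2 hg2
    simp only [comp_apply] at h
    rw [integral_sq_comp_eq' (hD.2 t) ham, integral_sq_comp_eq' hsev' ham] at h
    rw [hE₀]; exact h
  by_cases hsmall : n < n₀
  · simp only [if_pos hsmall]; exact htriv
  -- the main regime `n ≥ n₀`
  simp only [if_neg hsmall]
  have hn0 : n₀ ≤ n := not_lt.1 hsmall
  have hn0' : (n₀ : ℝ) ≤ n := by exact_mod_cast hn0
  have hn1 : (1 : ℝ) ≤ n := by linarith [hn₀1.trans hn0']
  -- the level `N = n / (2c)` and its bounds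
  obtain ⟨hN1, hNle, hC1⟩ := level_bounds (τ := τ) hc1 hAτc (hn₀1.trans hn0') (hn₀2.trans hn0')
  obtain ⟨N, hN⟩ : ∃ N : ℝ, N = (n : ℝ) / (2 * c) := ⟨_, rfl⟩
  rw [← hN] at hN1 hNle hC1
  have hN0 : 0 ≤ N := zero_le_one.trans hN1
  have h2cN : 2 * c * N = n := by rw [hN]; field_simp
  obtain ⟨hδle, hb_le⟩ := good_rate_le (da := da) hCa hL0 hK0 hτ hN0 hNle hn1
  have hδ1 : (2 + 22 * τ * K * N) * ((1 : ℝ) / 32) ^ (n - 1) ≤ 1 := hδle.trans (hn₁ n (hn₀4.trans hn0))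
  obtain ⟨hN', hsqrtη⟩ := tail_exponent_bounds (Cω := Cω) hc0 hlam₀ h2cN (hn₀3.trans hn0')
  rw [← hρ] at hsqrtη
  -- the bad event
  obtain ⟨B, hB⟩ : ∃ B : Set ChainConfig, B = {σ | ∃ r ∈ P.bmGrowthSet σ, N < r} ∪ (P.bmGood)ᶜ :=
    ⟨_, rfl⟩
  have hBm : MeasurableSet B := by
    rw [hB]
    exact (P.measurableSet_bmGrowthSet_gt hUm hVm N).union (P.measurableSet_bmGood hUm hVm).compl
  have hgood : ∀ σ, σ ∉ B → σ ∈ P.bmGood ∧ P.bmGrowth σ ≤ N := by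
    intro σ hσ
    rw [hB] at hσ
    have h1 : σ ∈ P.bmGood := by
      by_contra h
      exact hσ (Or.inr h)
    refine ⟨h1, csSup_le (bmGrowthSet_nonempty σ) fun r hr => ?_⟩
    by_contra h
    exact hσ (Or.inl ⟨r, hr, not_le.1 h⟩)
  -- pointwise bound off `B`
  have hb0 : 0 ≤ Ca * (L * N * (2 * n + 7)) ^ da * ((2 + 22 * τ * K * N) * ((1 : ℝ) / 32) ^ (n - 1)) := by
    positivity
  have hbound : ∀ σ, σ ∉ B → |a (D.flow t σ) -
      a (severedFlow hB1 (Finset.Icc ((0 : ℤ) - n) ((0 : ℤ) + n)) t σ)| ≤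
      Ca * (L * N * (2 * n + 7)) ^ da * ((2 + 22 * τ * K * N) * ((1 : ℝ) / 32) ^ (n - 1)) := by
    intro σ hσ
    obtain ⟨hσg, hQ⟩ := hgood σ hσ
    exact hdet N hN1 σ hσg hQ τ hτ n hC1 hδ1 t ht
  -- measure of the bad event
  have hBμ : μ.real B ≤ Kμ.toReal * Real.exp (-(lam₀ * N - Cω) / 2) ^ 2 := by
    have hη2 : Real.exp (-(lam₀ * N - Cω) / 2) ^ 2 = Real.exp (-(lam₀ * N - Cω)) := by
      rw [← Real.exp_nat_mul]; congr 1; push_cast; ring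
    rw [hη2]
    have h1 : μ B ≤ μ {σ | ∃ r ∈ P.bmGrowthSet σ, N < r} + μ (P.bmGood)ᶜ := by
      rw [hB]; exact measure_union_le _ _
    have h2 : μ (P.bmGood)ᶜ = 0 := by
      have h := hD.1
      rw [hcar, ae_iff] at h
      exact h
    rw [h2, add_zero] at h1
    have h4 : μ B ≤ ENNReal.ofReal (Real.exp (-(lam₀ * N - Cω))) * Kμ := h1.trans (htail N hN')
    calc μ.real B = (μ B).toReal := rfl
      _ ≤ (ENNReal.ofReal (Real.exp (-(lam₀ * N - Cω))) * Kμ).toReal :=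
          ENNReal.toReal_mono (ENNReal.mul_ne_top ENNReal.ofReal_ne_top hKμ) h4
      _ = Kμ.toReal * Real.exp (-(lam₀ * N - Cω)) := by
          rw [ENNReal.toReal_mul, ENNReal.toReal_ofReal (Real.exp_nonneg _), mul_comm]
  -- the splitting with `θ = η := e^{-(λ₀ N - C_ω)/2}`
  have hη0 : 0 < Real.exp (-(lam₀ * N - Cω) / 2) := Real.exp_pos _
  have hf4 : Integrable (fun σ => a (D.flow t σ) ^ 4) μ := (hD.2 t).integrable_comp_of_integrable ha4
  have hg4 : Integrable (fun σ => a (severedFlow hB1 (Finset.Icc ((0 : ℤ) - n) ((0 : ℤ) + n)) t σ) ^ 4) μ :=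
    hsev'.integrable_comp_of_integrable ha4
  obtain ⟨-, hsplit⟩ := integral_sub_sq_le_of_bound_off (f := fun σ => a (D.flow t σ))
    (g := fun σ => a (severedFlow hB1 (Finset.Icc ((0 : ℤ) - n) ((0 : ℤ) + n)) t σ))
    (ham.comp (hD.2 t).measurable) (ham.comp (measurable_severedFlow hB1 _ hU hV t)) hf4 hg4 hBm hη0
    hbound
  have hI1 : ∫ σ, a (D.flow t σ) ^ 4 ∂μ = M₄ := by rw [hM₄]; exact integral_pow_four_comp_eq (hD.2 t) ham
  have hI2 : ∫ σ, a (severedFlow hB1 (Finset.Icc ((0 : ℤ) - n) ((0 : ℤ) + n)) t σ) ^ 4 ∂μ = M₄ := by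
    rw [hM₄]; exact integral_pow_four_comp_eq hsev' ham
  rw [hI1, hI2, probReal_univ, mul_one] at hsplit
  have hfin := sqrt_le_of_split hb0 hb_le hη0 hM₄0 ENNReal.toReal_nonneg hBμ hsplit
  rw [← hCb] at hfin
  refine hfin.trans ?_
  have h1 : Real.sqrt (2 * (M₄ + Kμ.toReal)) * Real.sqrt (Real.exp (-(lam₀ * N - Cω) / 2)) ≤ Cη * ρ ^ n := by
    calc Real.sqrt (2 * (M₄ + Kμ.toReal)) * Real.sqrt (Real.exp (-(lam₀ * N - Cω) / 2))
        ≤ Real.sqrt (2 * (M₄ + Kμ.toReal)) * (Real.exp (Cω / 4) * ρ ^ n) :=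
          mul_le_mul_of_nonneg_left hsqrtη (Real.sqrt_nonneg _)
      _ = Cη * ρ ^ n := by rw [hCη]; ring
  linarith

end Summit.AtomisticToContinuum.FouriersLaw.Theorems.DrudeDissolution.GramPencilHarmonicChaos

end
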